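import Literature.Geometry.DiscreteGeometry.KissingFacetPenalty
import Literature.Geometry.DiscreteGeometry.KissingNodeDegree
import HarnessLib

/-!
# At most four contacts at each point of the unit configuration `V/2`
# (Hales 2012, Lemma 7 in the unit-sphere dictionary) — proved

Topic `Literature/Geometry/DiscreteGeometry`.  `KissingNodeDegree.lean` proves Hales's Lemma 7
(every node of the contact graph of `V ∈ 𝒱` has degree `≤ 4`) over the sphere of radius `2`;
the fan-refined Delaunay triangulation and the linear programs live on the unit configuration
`X = V/2` (`IsKissingConfig.unitConfig`, `KissingFacetPenalty.lean`), where a contact pair is a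
pair with inner product `1/2`.  This file transports the bound:

* `IsKissingConfig.card_filter_inner_eq_half_le_four`: for `y ∈ V/2`, at most four points
  `u ∈ V/2` have `⟪y, u⟫ = 1/2` — by scaling back to `S = V` and `card_le_four_of_neighbours`
  (a contact pair `⟪y, u⟫ = 1/2` of unit vectors is at distance `1`, i.e. `2` after doubling).

Everything is PROVED; no named facts.

## References
* T. C. Hales, arXiv:1209.6043 (2012), Lemma 7 ("every node of `(V, E₂(V))` has degree at most
  four"). [`Hales2012`]
-/

noncomputable section

namespace Literature.Geometry.DiscreteGeometry

open Real RealInnerProductSpace Finset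

local notation "E3" => EuclideanSpace ℝ (Fin 3)

section UnitContactDegree

variable {S : Set E3}

/-- Unit vectors with inner product `1/2` are at distance `1`. [folklore] -/
theorem dist_eq_one_of_inner_eq_half {y u : E3} (hy : ‖y‖ = 1) (hu : ‖u‖ = 1)
    (h : ⟪y, u⟫ = 1 / 2) : dist u y = 1 := by
  have hsq : dist u y ^ 2 = 1 := by
    rw [dist_eq_norm, ← real_inner_self_eq_norm_sq, inner_sub_left, inner_sub_right,
      inner_sub_right, real_inner_self_eq_norm_sq, real_inner_self_eq_norm_sq, hu, hy,
      real_inner_comm y u, h]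
    norm_num
  have h0 : 0 ≤ dist u y := dist_nonneg
  nlinarith [hsq]

/-- **At most four contacts at each point of `V/2`** (Lemma 7 in the unit-sphere dictionary):
for `y ∈ V/2`, `#{u ∈ V/2 | ⟪y, u⟫ = 1/2} ≤ 4`. [cite: Hales2012, Lemma 7] -/
theorem IsKissingConfig.card_filter_inner_eq_half_le_four (hS : IsKissingConfig S) {y : E3}
    (hy : y ∈ hS.unitConfig) :
    (hS.unitConfig.filter fun u => ⟪y, u⟫ = 1 / 2).card ≤ 4 := by
  classical
  set C := hS.unitConfig.filter fun u => ⟪y, u⟫ = 1 / 2 with hC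
  -- double everything: `F = 2 • C ⊆ S`, `v = 2 • y ∈ S`
  set F : Finset E3 := C.image fun u => (2 : ℝ) • u with hF
  have hinj : Function.Injective fun u : E3 => (2 : ℝ) • u :=
    smul_right_injective E3 (by norm_num : (2 : ℝ) ≠ 0)
  have hcard : F.card = C.card := Finset.card_image_of_injective _ hinj
  rw [← hcard]
  have hy1 : ‖y‖ = 1 := hS.norm_of_mem_unitConfig hy
  have hv : ‖(2 : ℝ) • y‖ = 2 := by rw [norm_smul, hy1]; norm_num
  -- members of `C`: unit, in `V/2`, inner product `1/2` with `y`
  have hmemC : ∀ u ∈ C, u ∈ hS.unitConfig ∧ ⟪y, u⟫ = 1 / 2 := fun u hu => by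
    simpa [hC, Finset.mem_filter] using hu
  -- doubling a point of `V/2` gives a point of `S`
  have hmemS : ∀ u ∈ hS.unitConfig, (2 : ℝ) • u ∈ S := fun u hu => by
    obtain ⟨s, hs, rfl⟩ := hS.mem_unitConfig.1 hu
    rw [smul_smul]; norm_num; exact hs
  refine card_le_four_of_neighbours hv (F := F) ?_ ?_ ?_
  · -- norms
    intro w hw
    obtain ⟨u, hu, rfl⟩ := Finset.mem_image.1 hw
    exact hS.norm_eq (hmemS u (hmemC u hu).1)
  · -- distances to `2 • y`
    intro w hw
    obtain ⟨u, hu, rfl⟩ := Finset.mem_image.1 hw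
    obtain ⟨huX, hyu⟩ := hmemC u hu
    have hd := dist_eq_one_of_inner_eq_half hy1 (hS.norm_of_mem_unitConfig huX) hyu
    rw [dist_smul₀, hd]; norm_num
  · -- separation inside `S`
    intro w hw w' hw' hne
    obtain ⟨u, hu, rfl⟩ := Finset.mem_image.1 hw
    obtain ⟨u', hu', rfl⟩ := Finset.mem_image.1 hw'
    rcases hS.2.2 _ (hmemS u (hmemC u hu).1) _ (hmemS u' (hmemC u' hu').1) with h | h | h
    · exact absurd h hne
    · exact Or.inl h
    · exact Or.inr h

end UnitContactDegree

end Literature.Geometry.DiscreteGeometry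

end
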